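import Summits.KontsevichZagierPeriods.KontsevichZagierPeriods.Theorems.LinRedNormalFormHoffmanSpanInKZFastCert

/-!
# Crux `LinRedNormalForm.HoffmanSpanInKZ` (stmt-KontsevichZagierPeriods-15044), line `Sketch`:
# CHUNKED fast mod-`p` transcripts — independent chunk facts and their assembly

The fast checkers `dtableOkC` / `wtableOkC` of `LinRedNormalFormHoffmanSpanInKZFastCert` thread a memory (the
claimed vectors seen so far, resp. the word codes certified so far) through the table.  A large transcript is
kernel-checked CHUNK BY CHUNK: chunk `k` is checked against the memory of the chunks `< k`, which is a pure
function of the DATA of the earlier chunks (`dmemOf`, `wprevOf`) — so the chunk facts `dchunkOkC … k = true` /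
`wchunkOkC … k = true` are mutually independent theorems (each a `decide +kernel` in its own file, verifiable in
parallel), and only the assembly (`dtableOkC_flatten_of_chunks`, `wtableOkC_flatten_of_chunks`,
`edsCertificate_of_chunks`, with the counting combinators `forallLt_base` / `forallLt_succ`) depends on all
of them.  This replaces the sequential part-file chain used at weights `11` and `12`.

Sources: the reflection set-up of `LinRedNormalFormHoffmanSpanInKZFastCert` (this tree). [folklore]
-/

namespace Summit.KontsevichZagierPeriods.LinRedNormalForm.HoffmanSpanInKZ

open Literature.NumberTheory.Transcendental
open Summit.KontsevichZagierPeriods.MzvKernelInKZ.Negative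
open Summit.KontsevichZagierPeriods.MzvKernelInKZ.TwoPosets

/-! ## Counting combinators (assembling `∀ k < K` from `K` facts) -/

/-- The first fact starts the count: `P 0` gives `∀ k < 1, P k`. [folklore] -/
theorem forallLt_base (P : ℕ → Prop) (h0 : P 0) : ∀ k < 1, P k :=
  fun _ hk => (Nat.lt_one_iff.1 hk).symm ▸ h0

/-- One more fact extends `∀ k < n` to `∀ k < n + 1`. [folklore] -/
theorem forallLt_succ {P : ℕ → Prop} {n : ℕ} (h : ∀ k < n, P k) (hn : P n) : ∀ k < n + 1, P k := by
  intro k hk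
  rcases Nat.lt_succ_iff_lt_or_eq.1 hk with hk | rfl
  exacts [h k hk, hn]

/-! ## Derived rows in chunks -/

/-- The blocked memory of the claimed vectors of the first `k` chunks. [folklore] -/
def dmemOf (p : ℕ) (chunks : List (List DRowP)) (k : ℕ) : List (List (List (ℕ × ℕ))) :=
  pushAllB [] (((chunks.take k).flatten).map (DRowP.cvec p))

/-- Chunk `k` of a chunked derived table checks against the memory of the chunks `< k`. [folklore] -/
def dchunkOkC (p N : ℕ) (chunks : List (List DRowP)) (k : ℕ) : Bool :=
  dtableOkC p N (dmemOf p chunks k) (chunks.getD k [])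

/-- `pushAllB` over an append. [folklore] -/
theorem pushAllB_append (mem : List (List (List (ℕ × ℕ)))) (vs ws : List (List (ℕ × ℕ))) :
    pushAllB mem (vs ++ ws) = pushAllB (pushAllB mem vs) ws := by
  simp [pushAllB, List.foldl_append]

/-- Chunked derived-table checks assemble to a check of the whole table, from any memory. [folklore] -/
theorem dtableOkC_flatten_of_chunks_aux (p N : ℕ) :
    ∀ (chunks : List (List DRowP)) (mem : List (List (List (ℕ × ℕ)))),
      (∀ k < chunks.length,
        dtableOkC p N (pushAllB mem (((chunks.take k).flatten).map (DRowP.cvec p))) (chunks.getD k []) = true) →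
      dtableOkC p N mem chunks.flatten = true
  | [], _, _ => rfl
  | c :: cs, mem, h => by
    rw [List.flatten_cons]
    refine dtableOkC_append c cs.flatten mem ?_ ?_
    · simpa [pushAllB] using h 0 (by simp)
    · refine dtableOkC_flatten_of_chunks_aux p N cs (pushAllB mem (c.map (DRowP.cvec p))) fun k hk => ?_
      have := h (k + 1) (by simpa using hk)
      simpa [List.take_succ_cons, List.flatten_cons, List.map_append, pushAllB_append] using this

/-- **Chunked derived-table checks assemble** to `dtableOkC p N [] chunks.flatten = true`. [folklore] -/
theorem dtableOkC_flatten_of_chunks (p N : ℕ) (chunks : List (List DRowP))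
    (h : ∀ k < chunks.length, dchunkOkC p N chunks k = true) : dtableOkC p N [] chunks.flatten = true :=
  dtableOkC_flatten_of_chunks_aux p N chunks [] fun k hk => by simpa [dchunkOkC, dmemOf] using h k hk

/-! ## Word rows in chunks -/

/-- The word codes certified by the first `k` word chunks, latest first. [folklore] -/
def wprevOf (wchunks : List (List WRowP)) (k : ℕ) : List ℕ :=
  (((wchunks.take k).flatten).map WRowP.w).reverse

/-- Chunk `k` of a chunked word table checks against the codes certified by the chunks `< k`. [folklore] -/
def wchunkOkC (p N : ℕ) (dv : List (List (List (ℕ × ℕ)))) (wchunks : List (List WRowP)) (k : ℕ) : Bool :=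
  wtableOkC p N dv (wprevOf wchunks k) (wchunks.getD k [])

/-- Chunked word-table checks assemble to a check of the whole table, from any list of certified codes.
[folklore] -/
theorem wtableOkC_flatten_of_chunks_aux (p N : ℕ) (dv : List (List (List (ℕ × ℕ)))) :
    ∀ (wchunks : List (List WRowP)) (prev : List ℕ),
      (∀ k < wchunks.length,
        wtableOkC p N dv ((((wchunks.take k).flatten).map WRowP.w).reverse ++ prev) (wchunks.getD k []) = true) →
      wtableOkC p N dv prev wchunks.flatten = true
  | [], _, _ => rfl
  | c :: cs, prev, h => by
    rw [List.flatten_cons]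
    refine wtableOkC_append dv c cs.flatten prev ?_ ?_
    · simpa using h 0 (by simp)
    · refine wtableOkC_flatten_of_chunks_aux p N dv cs ((c.map WRowP.w).reverse ++ prev) fun k hk => ?_
      have := h (k + 1) (by simpa using hk)
      simpa [List.take_succ_cons, List.flatten_cons, List.map_append, List.reverse_append,
        List.append_assoc] using this

/-- **Chunked word-table checks assemble** to `wtableOkC p N dv [] wchunks.flatten = true`. [folklore] -/
theorem wtableOkC_flatten_of_chunks (p N : ℕ) (dv : List (List (List (ℕ × ℕ)))) (wchunks : List (List WRowP))
    (h : ∀ k < wchunks.length, wchunkOkC p N dv wchunks k = true) :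
    wtableOkC p N dv [] wchunks.flatten = true :=
  wtableOkC_flatten_of_chunks_aux p N dv wchunks [] fun k hk => by
    simpa [wchunkOkC, wprevOf] using h k hk

/-! ## Assembly -/

/-- The memory of ALL claimed vectors of a chunked derived table (what the word chunks cite). [folklore] -/
def dmemAll (p : ℕ) (chunks : List (List DRowP)) : List (List (List (ℕ × ℕ))) :=
  pushAllB [] ((chunks.flatten).map (DRowP.cvec p))

/-- **From chunk facts to `EdsCertificate N`**: the derived chunks check one after the other, the word chunks
check against all claimed vectors, and the word rows cover the admissible words. [folklore] -/
theorem edsCertificate_of_chunks (p N : ℕ) [Fact p.Prime] (dch : List (List DRowP)) (wch : List (List WRowP))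
    (hd : ∀ k < dch.length, dchunkOkC p N dch k = true)
    (hw : ∀ k < wch.length, wchunkOkC p N (dmemAll p dch) wch k = true)
    (hcover : (allWords N).all (fun l => decide (Adm (wordOf N l) →
      l ∈ (wch.flatten).map fun c => wordOfCode N c.w)) = true) : EdsCertificate N :=
  edsCertificate_of_ctables p N dch.flatten wch.flatten (dtableOkC_flatten_of_chunks p N dch hd)
    (wtableOkC_flatten_of_chunks p N _ wch hw) hcover

/-! ## The registered stub -/

/-- Soundness of chunked fast-checked mod-`p` transcripts, as a statement about this file's checkers (not a
published fact). -/
def FastChunksSound : Prop :=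
  ∀ (p N : ℕ) [Fact p.Prime] (dch : List (List DRowP)) (wch : List (List WRowP)),
    (∀ k < dch.length, dchunkOkC p N dch k = true) →
      (∀ k < wch.length, wchunkOkC p N (dmemAll p dch) wch k = true) →
        (allWords N).all (fun l => decide (Adm (wordOf N l) →
          l ∈ (wch.flatten).map fun c => wordOfCode N c.w)) = true →
          EdsCertificate N

/-- **Registered stub `stub_fastChunks`** of the skeleton of line `Sketch`: the chunked layout is sound. -/
theorem stub_fastChunks : FastChunksSound := fun p N _ dch wch h₁ h₂ h₃ =>
  edsCertificate_of_chunks p N dch wch h₁ h₂ h₃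

/-! ## Smoke test (kernel), weight `4`, modulo `65521`, two derived chunks and two word chunks -/

/-- Smoke-test derived chunks (weight `4`). -/
def dchTest4 : List (List DRowP) :=
  [[⟨.F [2] [2], [], [(1, 65520), (3, 4)]⟩, ⟨.D [3], [(0, 49141)], [(1, 16381), (5, 65520)]⟩],
   [⟨.K [2, 1, 1], [], [(1, 65520), (7, 1)]⟩]]

/-- Smoke-test word chunks (weight `4`). -/
def wchTest4 : List (List WRowP) :=
  [[⟨5, [], [([2, 2], 1)], []⟩, ⟨1, [], [([2, 2], 43682)], [(1, 43682)]⟩],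
   [⟨3, [(1, 49141)], [], [(0, 49141)]⟩, ⟨7, [(1, 1)], [], [(2, 1)]⟩]]

example : dchunkOkC 65521 4 dchTest4 0 = true := by decide +kernel
example : dchunkOkC 65521 4 dchTest4 1 = true := by decide +kernel
example : wchunkOkC 65521 4 (dmemAll 65521 dchTest4) wchTest4 0 = true := by decide +kernel
example : wchunkOkC 65521 4 (dmemAll 65521 dchTest4) wchTest4 1 = true := by decide +kernel

/-- Smoke test of the assembly shape: `EdsCertificate 4` from the four chunk facts and coverage. -/
example : EdsCertificate 4 :=
  edsCertificate_of_chunks 65521 4 dchTest4 wchTest4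
    (forallLt_succ (n := 1)
      (forallLt_base (fun k => dchunkOkC 65521 4 dchTest4 k = true) (by decide +kernel)) (by decide +kernel))
    (forallLt_succ (n := 1)
      (forallLt_base (fun k => wchunkOkC 65521 4 (dmemAll 65521 dchTest4) wchTest4 k = true)
        (by decide +kernel)) (by decide +kernel))
    (by decide +kernel)

end Summit.KontsevichZagierPeriods.LinRedNormalForm.HoffmanSpanInKZ
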